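import Summits.QuantumFields.QCD.Theses.SpectralDefectExtinction
import Literature.Probability.LatticeModels.TorusFourierProofs

/-!
# Torus Fourier toolkit and the Sobolev sup bound: stub `stub_sobolevSup` of line
# `positivity-no-leak-spread` for crux `TipNoBinding` (stmt-QuantumFields-8965)

Shared Fourier infrastructure on the discrete torus `(ℤ/Lℤ)^d` (over the tree's `torusFourier`,
`torusChar`, inversion and Plancherel of `Literature.Probability.LatticeModels.TorusFourier(Proofs)`):

* `torusFourier_comp_add` / `torusFourier_comp_sub` — a translate has Fourier transform multiplied by
  the character (`𝓕(f(· + e))(k) = χ_k(e) 𝓕f(k)`);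
* `torusChar_single_eq_exp`, `norm_sq_torusChar_single_sub_one` — `χ_k(e_μ) = e^{iθ}`,
  `θ = 2π k_μ.val / L`, and `‖χ_k(e_μ) − 1‖² = 4 sin²(π k_μ.val / L)`;
* `sum_norm_sq_eq_fourier` (Parseval with the `L^{-d}` on the Fourier side),
  `sum_norm_sq_shift_sub_eq_fourier` (the lattice Dirichlet energy in Fourier variables),
  `norm_sq_torusFourier_le_card_mul` (Cauchy–Schwarz on a support set),
  `symbol_pos_of_ne_zero` (`Σ_μ 4 sin²(π k_μ.val/L) > 0` for `k ≠ 0`).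

With these, `stub_sobolevSup` — for real `f` on `(ℤ/L)⁴` and every site `x`,
`f(x)² ≤ (2/L⁴) Σ_y f(y)² + 2 K_L E(f)`, `K_L = L⁻⁴ Σ_{k≠0} 1/ε_L(k)`, `ε_L(k) = Σ_μ 4 sin²(π k_μ/L)`,
`E(f) = Σ_{y,μ} (f(y+μ̂) − f(y))²` — follows by splitting the inversion formula into the zero mode
(Cauchy–Schwarz against the `L⁴` sites) and the oscillating part (Cauchy–Schwarz against the weights
`ε_L(k)`, `k ≠ 0`).  References: Friedli–Velenik 2017 §10.4 (torus Fourier analysis); the Sobolev/Poincaré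
step is folklore.
-/

namespace Summit.QuantumFields.QCD.Cruxes.TipNoBinding.PositivityNoLeakSpread

open Literature.MathematicalPhysics Literature.MathematicalPhysics.QuantumLattice
  Literature.MathematicalPhysics.QuantumFieldTheory Literature.Probability.LatticeModels
open Matrix Complex ZMod Finset
open scoped ComplexConjugate Real

section Toolkit

variable {d L : ℕ} [NeZero L]

/-- `torusFourier` is additive. -/
theorem torusFourier_add (f g : TorusSite d L → ℂ) (k : TorusSite d L) :
    torusFourier (f + g) k = torusFourier f k + torusFourier g k := by
  simp only [torusFourier, Pi.add_apply, add_mul, Finset.sum_add_distrib]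

/-- `torusFourier` commutes with subtraction. -/
theorem torusFourier_sub (f g : TorusSite d L → ℂ) (k : TorusSite d L) :
    torusFourier (f - g) k = torusFourier f k - torusFourier g k := by
  simp only [torusFourier, Pi.sub_apply, sub_mul, Finset.sum_sub_distrib]

/-- `torusFourier` is homogeneous. -/
theorem torusFourier_const_mul (c : ℂ) (f : TorusSite d L → ℂ) (k : TorusSite d L) :
    torusFourier (fun x => c * f x) k = c * torusFourier f k := by
  simp only [torusFourier, Finset.mul_sum, mul_assoc]

/-- **Shift multiplier**: `𝓕(f(· + e))(k) = χ_k(e) · 𝓕f(k)`. -/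
theorem torusFourier_comp_add (f : TorusSite d L → ℂ) (e k : TorusSite d L) :
    torusFourier (fun x => f (x + e)) k = torusChar k e * torusFourier f k := by
  rw [torusFourier_eq_sum_torusChar, torusFourier_eq_sum_torusChar, Finset.mul_sum]
  refine Fintype.sum_equiv (Equiv.addRight e) _ _ fun x => ?_
  rw [Equiv.coe_addRight, torusChar_add_right, map_mul]
  have h := torusChar_mul_conj k e
  linear_combination (-(f (x + e) * (starRingEnd ℂ) (torusChar k x))) * h

/-- **Shift multiplier**, backward: `𝓕(f(· − e))(k) = conj χ_k(e) · 𝓕f(k)`. -/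
theorem torusFourier_comp_sub (f : TorusSite d L → ℂ) (e k : TorusSite d L) :
    torusFourier (fun x => f (x - e)) k = conj (torusChar k e) * torusFourier f k := by
  have h := torusFourier_comp_add f (-e) k
  simp only [← sub_eq_add_neg, torusChar_neg_right] at h
  exact h

/-- The character at a unit vector is the one-dimensional standard character: `χ_k(e_μ) = e(k_μ)`. -/
theorem torusChar_single (k : TorusSite d L) (μ : Fin d) :
    torusChar k (Pi.single μ 1) = stdAddChar (k μ) := by
  classical
  unfold torusChar
  rw [Finset.prod_eq_single μ]
  · simp
  · intro i _ hi
    simp [Pi.single_eq_of_ne hi]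
  · simp

/-- `χ_k(e_μ) = exp(iθ)` with `θ = 2π k_μ.val / L`. -/
theorem torusChar_single_eq_exp (k : TorusSite d L) (μ : Fin d) :
    torusChar k (Pi.single μ 1) =
      Complex.exp ((2 * π * ((k μ).val : ℝ) / L : ℝ) * I) := by
  rw [torusChar_single, stdAddChar_apply, toCircle_apply]
  congr 1
  push_cast
  ring

/-- `Re χ_k(e_μ) = cos θ`, `θ = 2π k_μ.val / L`. -/
theorem torusChar_single_re (k : TorusSite d L) (μ : Fin d) :
    (torusChar k (Pi.single μ 1)).re = Real.cos (2 * π * ((k μ).val : ℝ) / L) := by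
  rw [torusChar_single_eq_exp, Complex.exp_ofReal_mul_I_re]

/-- `Im χ_k(e_μ) = sin θ`, `θ = 2π k_μ.val / L`. -/
theorem torusChar_single_im (k : TorusSite d L) (μ : Fin d) :
    (torusChar k (Pi.single μ 1)).im = Real.sin (2 * π * ((k μ).val : ℝ) / L) := by
  rw [torusChar_single_eq_exp, Complex.exp_ofReal_mul_I_im]

/-- **The multiplier of the forward difference**: `‖χ_k(e_μ) − 1‖² = 4 sin²(π k_μ.val / L)`. -/
theorem norm_sq_torusChar_single_sub_one (k : TorusSite d L) (μ : Fin d) :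
    ‖torusChar k (Pi.single μ 1) - 1‖ ^ 2 = 4 * Real.sin (π * ((k μ).val : ℝ) / L) ^ 2 := by
  rw [torusChar_single_eq_exp, mul_comm _ I, Complex.norm_exp_I_mul_ofReal_sub_one, Real.norm_eq_abs,
    sq_abs, mul_pow]
  congr 1
  · norm_num
  · congr 2
    ring

/-- **Parseval** with the normalisation on the Fourier side: `Σ_x ‖f x‖² = L^{-d} Σ_k ‖𝓕f(k)‖²`. -/
theorem sum_norm_sq_eq_fourier (f : TorusSite d L → ℂ) :
    ∑ x, ‖f x‖ ^ 2 = (1 / (L : ℝ) ^ d) * ∑ k, ‖torusFourier f k‖ ^ 2 := by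
  have h := torusFourier_plancherel_holds (d := d) (L := L) f
  have hL : (0 : ℝ) < (L : ℝ) ^ d := pow_pos (Nat.cast_pos.mpr (Nat.pos_of_ne_zero (NeZero.ne L))) d
  rw [h]
  field_simp

/-- **The lattice Dirichlet energy in Fourier variables** (one direction `e`):
`Σ_x ‖f(x+e) − f(x)‖² = L^{-d} Σ_k ‖χ_k(e) − 1‖² ‖𝓕f(k)‖²`. -/
theorem sum_norm_sq_shift_sub_eq_fourier (f : TorusSite d L → ℂ) (e : TorusSite d L) :
    ∑ x, ‖f (x + e) - f x‖ ^ 2 =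
      (1 / (L : ℝ) ^ d) * ∑ k, ‖torusChar k e - 1‖ ^ 2 * ‖torusFourier f k‖ ^ 2 := by
  have h := sum_norm_sq_eq_fourier (d := d) (L := L) (fun x => f (x + e) - f x)
  rw [h]
  congr 1
  refine Finset.sum_congr rfl fun k _ => ?_
  have hk : torusFourier (fun x => f (x + e) - f x) k = (torusChar k e - 1) * torusFourier f k := by
    have := torusFourier_sub (fun x => f (x + e)) f k
    rw [show ((fun x => f (x + e)) - f) = fun x => f (x + e) - f x from rfl] at this
    rw [this, torusFourier_comp_add, sub_mul, one_mul]
  rw [hk, norm_mul, mul_pow]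

/-- **Cauchy–Schwarz on a support set**: if `f` vanishes off `S` then `‖𝓕f(k)‖² ≤ |S| Σ_{x∈S} ‖f x‖²`. -/
theorem norm_sq_torusFourier_le_card_mul (f : TorusSite d L → ℂ) (S : Finset (TorusSite d L))
    (hf : ∀ x, x ∉ S → f x = 0) (k : TorusSite d L) :
    ‖torusFourier f k‖ ^ 2 ≤ S.card * ∑ x ∈ S, ‖f x‖ ^ 2 := by
  classical
  rw [torusFourier_eq_sum_torusChar]
  have hS : ∑ x, f x * conj (torusChar k x) = ∑ x ∈ S, f x * conj (torusChar k x) := by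
    refine (Finset.sum_subset (Finset.subset_univ S) fun x _ hx => ?_).symm
    rw [hf x hx, zero_mul]
  rw [hS]
  calc ‖∑ x ∈ S, f x * conj (torusChar k x)‖ ^ 2
      ≤ (∑ x ∈ S, ‖f x * conj (torusChar k x)‖) ^ 2 := by
        gcongr
        exact norm_sum_le _ _
    _ = (∑ x ∈ S, ‖f x‖) ^ 2 := by
        congr 1
        refine Finset.sum_congr rfl fun x _ => ?_
        rw [norm_mul, Complex.norm_conj, norm_torusChar, mul_one]
    _ ≤ S.card * ∑ x ∈ S, ‖f x‖ ^ 2 := sq_sum_le_card_mul_sum_sq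

omit [NeZero L] in
/-- The symbol `ε_L(k) = Σ_μ 4 sin²(π k_μ.val / L)` of the lattice Laplacian is nonnegative. -/
theorem symbol_nonneg (k : TorusSite d L) :
    0 ≤ ∑ μ, 4 * Real.sin (π * ((k μ).val : ℝ) / L) ^ 2 :=
  Finset.sum_nonneg fun _ _ => by positivity

/-- The symbol `ε_L(k)` is positive off the zero mode. -/
theorem symbol_pos_of_ne_zero {k : TorusSite d L} (hk : k ≠ 0) :
    0 < ∑ μ, 4 * Real.sin (π * ((k μ).val : ℝ) / L) ^ 2 := by
  obtain ⟨μ, hμ⟩ : ∃ μ, k μ ≠ 0 := by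
    by_contra h
    push Not at h
    exact hk (funext h)
  have hL : (0 : ℝ) < L := Nat.cast_pos.mpr (Nat.pos_of_ne_zero (NeZero.ne L))
  have hv0 : 0 < ((k μ).val : ℝ) := by
    have : (k μ).val ≠ 0 := (ZMod.val_ne_zero (k μ)).mpr hμ
    exact_mod_cast Nat.pos_of_ne_zero this
  have hvL : ((k μ).val : ℝ) < L := by exact_mod_cast ZMod.val_lt (k μ)
  have hsin : 0 < Real.sin (π * ((k μ).val : ℝ) / L) := by
    apply Real.sin_pos_of_pos_of_lt_pi
    · positivity
    · rw [div_lt_iff₀ hL]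
      nlinarith [Real.pi_pos]
  refine Finset.sum_pos' (fun _ _ => by positivity) ⟨μ, Finset.mem_univ _, ?_⟩
  positivity

/-- `ε_L(k)` is the sum of the forward-difference multipliers: `Σ_μ ‖χ_k(e_μ) − 1‖² = ε_L(k)`. -/
theorem sum_norm_sq_torusChar_single_sub_one (k : TorusSite d L) :
    ∑ μ, ‖torusChar k (Pi.single μ 1) - 1‖ ^ 2 = ∑ μ, 4 * Real.sin (π * ((k μ).val : ℝ) / L) ^ 2 :=
  Finset.sum_congr rfl fun μ _ => norm_sq_torusChar_single_sub_one k μ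

end Toolkit

/-! ## The Sobolev sup bound on the four-torus -/

section Sobolev

/-- `card (TorusSite 4 L) = L⁴` as a real number. -/
theorem card_torusSite_four (L : ℕ) [NeZero L] :
    ((Finset.univ : Finset (TorusSite 4 L)).card : ℝ) = (L : ℝ) ^ 4 := by
  rw [Finset.card_univ]
  simp [Fintype.card_pi, ZMod.card]

/-- **SOBOLEV SUP BOUND on the four-torus** (scalar, exact constant; registered stub `stub_sobolevSup` of
line `positivity-no-leak-spread`): for every real `f` on `(ℤ/L)⁴` and every site `x`,
`f(x)² ≤ (2/L⁴) Σ_y f(y)² + 2 K_L E(f)` with `E(f) = Σ_{y,μ} (f(y+μ̂) − f(y))²` and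
`K_L = L⁻⁴ Σ_{k ≠ 0} 1/ε_L(k)`, `ε_L(k) = Σ_μ 4 sin²(π k_μ / L)`.
Proof: `f(x) = L⁻⁴ (𝓕f(0) + Σ_{k≠0} 𝓕f(k) χ_k(x))` (inversion); `|𝓕f(0)|² = |Σ_y f(y)|² ≤ L⁴ Σ f²`;
`|Σ_{k≠0} 𝓕f(k)χ_k(x)|² ≤ (Σ_{k≠0} ε(k)|𝓕f(k)|²)(Σ_{k≠0} 1/ε(k)) ≤ L⁴ E(f) · L⁴ K_L` (Cauchy–Schwarz and the
Dirichlet energy in Fourier variables); and `(a+b)² ≤ 2a² + 2b²`. -/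
theorem stub_sobolevSup :
    ∀ (L : ℕ) [NeZero L] (f : TorusSite 4 L → ℝ) (x : TorusSite 4 L),
      f x ^ 2 ≤ (2 / (L : ℝ) ^ 4) * ∑ y, f y ^ 2 +
        2 * ((1 / (L : ℝ) ^ 4) * ∑ k ∈ (Finset.univ : Finset (TorusSite 4 L)).filter (· ≠ 0),
              1 / (∑ μ, 4 * Real.sin (Real.pi * ((k μ).val : ℝ) / L) ^ 2)) *
          ∑ y, ∑ μ, (f (QuantumFieldTheory.Site.shift y μ) - f y) ^ 2 := by
  intro L _ f x
  classical
  -- notation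
  set F : TorusSite 4 L → ℂ := fun y => (f y : ℂ) with hFdef
  set ε : TorusSite 4 L → ℝ := fun k => ∑ μ, 4 * Real.sin (π * ((k μ).val : ℝ) / L) ^ 2 with hεdef
  set E : ℝ := ∑ y, ∑ μ, (f (QuantumFieldTheory.Site.shift y μ) - f y) ^ 2 with hEdef
  set B : ℝ := ∑ k ∈ (Finset.univ : Finset (TorusSite 4 L)).filter (· ≠ 0), 1 / ε k with hBdef
  set M : ℂ := torusFourier F 0 with hMdef
  set O : ℂ := ∑ k ∈ (Finset.univ : Finset (TorusSite 4 L)).filter (· ≠ 0),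
    torusFourier F k * torusChar k x with hOdef
  have hL : (0 : ℝ) < L := Nat.cast_pos.mpr (Nat.pos_of_ne_zero (NeZero.ne L))
  have hL4 : (0 : ℝ) < (L : ℝ) ^ 4 := by positivity
  have hE0 : 0 ≤ E := Finset.sum_nonneg fun _ _ => Finset.sum_nonneg fun _ _ => sq_nonneg _
  have hB0 : 0 ≤ B := Finset.sum_nonneg fun k _ => div_nonneg zero_le_one (symbol_nonneg k)
  -- Fourier inversion at `x`, zero mode split off
  have hinv : F x = ((L : ℂ) ^ 4)⁻¹ * (M + O) := by
    have h := congrFun (torusFourier_inversion_holds (d := 4) (L := L) F) x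
    rw [torusFourierInv_eq_sum_torusChar] at h
    rw [← h, ← Finset.add_sum_erase _ _ (Finset.mem_univ (0 : TorusSite 4 L)), torusChar_zero_left,
      mul_one, ← Finset.filter_ne']
  -- `f x² ≤ 2 L⁻⁸ (‖M‖² + ‖O‖²)`
  have hfx : f x ^ 2 ≤ 2 * (1 / (L : ℝ) ^ 4) ^ 2 * (‖M‖ ^ 2 + ‖O‖ ^ 2) := by
    have h1 : f x ^ 2 = ‖F x‖ ^ 2 := by
      rw [hFdef]
      simp only [Complex.norm_real, Real.norm_eq_abs, sq_abs]
    have h2 : ‖F x‖ ≤ (1 / (L : ℝ) ^ 4) * (‖M‖ + ‖O‖) := by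
      rw [hinv, norm_mul, norm_inv, norm_pow, Complex.norm_natCast, one_div]
      gcongr
      exact norm_add_le _ _
    have h3 : 0 ≤ (1 / (L : ℝ) ^ 4) * (‖M‖ + ‖O‖) := by positivity
    calc f x ^ 2 = ‖F x‖ ^ 2 := h1
      _ ≤ ((1 / (L : ℝ) ^ 4) * (‖M‖ + ‖O‖)) ^ 2 := pow_le_pow_left₀ (norm_nonneg _) h2 2
      _ = (1 / (L : ℝ) ^ 4) ^ 2 * (‖M‖ + ‖O‖) ^ 2 := by ring
      _ ≤ (1 / (L : ℝ) ^ 4) ^ 2 * (2 * (‖M‖ ^ 2 + ‖O‖ ^ 2)) := by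
          gcongr
          nlinarith [sq_nonneg (‖M‖ - ‖O‖)]
      _ = 2 * (1 / (L : ℝ) ^ 4) ^ 2 * (‖M‖ ^ 2 + ‖O‖ ^ 2) := by ring
  -- the zero mode: `‖M‖² ≤ L⁴ Σ f²`
  have hM : ‖M‖ ^ 2 ≤ (L : ℝ) ^ 4 * ∑ y, f y ^ 2 := by
    have h1 : M = ((∑ y, f y : ℝ) : ℂ) := by
      rw [hMdef, torusFourier_apply_zero, Complex.ofReal_sum]
    rw [h1, Complex.norm_real, Real.norm_eq_abs, sq_abs, ← card_torusSite_four L]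
    exact sq_sum_le_card_mul_sum_sq
  -- the Dirichlet energy in Fourier variables: `Σ_k ε(k) ‖𝓕F(k)‖² = L⁴ E`
  have hEF : ∑ k, ε k * ‖torusFourier F k‖ ^ 2 = (L : ℝ) ^ 4 * E := by
    have h1 : ∀ k, ε k * ‖torusFourier F k‖ ^ 2 =
        ∑ μ, ‖torusChar k (Pi.single μ 1) - 1‖ ^ 2 * ‖torusFourier F k‖ ^ 2 := fun k => by
      simp only [hεdef]
      rw [← sum_norm_sq_torusChar_single_sub_one k, Finset.sum_mul]
    simp_rw [h1]
    rw [Finset.sum_comm]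
    have h2 : ∀ μ : Fin 4, ∑ k, ‖torusChar k (Pi.single μ 1) - 1‖ ^ 2 * ‖torusFourier F k‖ ^ 2 =
        (L : ℝ) ^ 4 * ∑ y, (f (QuantumFieldTheory.Site.shift y μ) - f y) ^ 2 := fun μ => by
      have h := sum_norm_sq_shift_sub_eq_fourier (d := 4) (L := L) F (Pi.single μ 1)
      have h' : ∑ y, ‖F (y + Pi.single μ 1) - F y‖ ^ 2 =
          ∑ y, (f (QuantumFieldTheory.Site.shift y μ) - f y) ^ 2 := by
        refine Finset.sum_congr rfl fun y _ => ?_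
        rw [hFdef]
        simp only [QuantumFieldTheory.Site.shift, ← Complex.ofReal_sub, Complex.norm_real,
          Real.norm_eq_abs, sq_abs]
      rw [h'] at h
      rw [h]
      field_simp
    simp_rw [h2]
    rw [← Finset.mul_sum, hEdef, Finset.sum_comm]
  -- the oscillating part: `‖O‖² ≤ L⁴ E · B`
  have hO : ‖O‖ ^ 2 ≤ (L : ℝ) ^ 4 * E * B := by
    have h1 : ‖O‖ ≤ ∑ k ∈ (Finset.univ : Finset (TorusSite 4 L)).filter (· ≠ 0),
        ‖torusFourier F k‖ := by
      refine (norm_sum_le _ _).trans (le_of_eq (Finset.sum_congr rfl fun k _ => ?_))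
      rw [norm_mul, norm_torusChar, mul_one]
    have h2 : (∑ k ∈ (Finset.univ : Finset (TorusSite 4 L)).filter (· ≠ 0), ‖torusFourier F k‖) ^ 2 ≤
        (∑ k ∈ (Finset.univ : Finset (TorusSite 4 L)).filter (· ≠ 0), ε k * ‖torusFourier F k‖ ^ 2) *
          B := by
      refine sum_sq_le_sum_mul_sum_of_sq_le_mul _ (fun k _ => ?_) (fun k _ => ?_) (fun k hk => ?_)
      · exact mul_nonneg (symbol_nonneg k) (sq_nonneg _)
      · exact div_nonneg zero_le_one (symbol_nonneg k)
      · have hk : k ≠ 0 := (Finset.mem_filter.mp hk).2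
        have hεk : 0 < ε k := symbol_pos_of_ne_zero hk
        rw [show ε k * ‖torusFourier F k‖ ^ 2 * (1 / ε k) = ‖torusFourier F k‖ ^ 2 by
          field_simp]
    have h3 : ∑ k ∈ (Finset.univ : Finset (TorusSite 4 L)).filter (· ≠ 0), ε k * ‖torusFourier F k‖ ^ 2 ≤
        (L : ℝ) ^ 4 * E := by
      rw [← hEF]
      exact Finset.sum_le_sum_of_subset_of_nonneg (Finset.filter_subset _ _)
        fun k _ _ => mul_nonneg (symbol_nonneg k) (sq_nonneg _)
    calc ‖O‖ ^ 2 ≤ (∑ k ∈ (Finset.univ : Finset (TorusSite 4 L)).filter (· ≠ 0),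
          ‖torusFourier F k‖) ^ 2 := pow_le_pow_left₀ (norm_nonneg _) h1 2
      _ ≤ (∑ k ∈ (Finset.univ : Finset (TorusSite 4 L)).filter (· ≠ 0),
            ε k * ‖torusFourier F k‖ ^ 2) * B := h2
      _ ≤ (L : ℝ) ^ 4 * E * B := mul_le_mul_of_nonneg_right h3 hB0
  -- assemble
  have hSf : 0 ≤ ∑ y, f y ^ 2 := Finset.sum_nonneg fun _ _ => sq_nonneg _
  calc f x ^ 2 ≤ 2 * (1 / (L : ℝ) ^ 4) ^ 2 * (‖M‖ ^ 2 + ‖O‖ ^ 2) := hfx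
    _ ≤ 2 * (1 / (L : ℝ) ^ 4) ^ 2 * ((L : ℝ) ^ 4 * ∑ y, f y ^ 2 + (L : ℝ) ^ 4 * E * B) := by
        gcongr
    _ = (2 / (L : ℝ) ^ 4) * ∑ y, f y ^ 2 + 2 * ((1 / (L : ℝ) ^ 4) * B) * E := by
        field_simp

end Sobolev

end Summit.QuantumFields.QCD.Cruxes.TipNoBinding.PositivityNoLeakSpread
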